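/-
Copyright (c) 2026. All rights reserved.
Released under Apache 2.0 license as described in the file LICENSE.
Authors: HodgeCM publication cell (pub-hodgecm), GR lane, seat GR-1 (`pub-hodgecm-own-real34`), on GR-2's `GRConstructionGen` chain.
-/
import Literature.NumberTheory.GelbartRogawski1991.DoubledWeilRepresentationArchHalfReal
import Literature.NumberTheory.GelbartRogawski1991.Prop311AsPrintedOfArchHalf
import Literature.NumberTheory.GelbartRogawski1991.QuadExtRealPlacesEquiv
import HarnessLib

/-!
# [GelbartRogawski1991, Proposition 3.1.1] AS PRINTED — PROVED (every quadratic `E/F`)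

Topic `NumberTheory/GelbartRogawski1991`; namespaces `Literature.NumberTheory.GelbartRogawski1991.GRConstructionGen` and
`….Prop311`.  Theorems only; no definition, no named fact, no `sorry`, no instance attribute.

`Prop311AsPrintedOfArchHalf.prop311AsPrinted_of_diagonalArchHalf` reduced the statement-exact typing `Prop311AsPrinted` of
[GR91 Prop. 3.1.1] (quantified over EVERY quadratic extension of number fields `E/F`, every non-degenerate hermitian space and its
doubled unitary group) to the ARCHIMEDEAN HALF at diagonal Gram data: `∃ sa, IsArchHalf F E c hcδ hδ hd e (diag dV) … (diag dW) … χ sa`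
for every unitary Hecke character `χ` of `E` with `χ|_{𝕀_F} = ε_{E/F}`.  That half is
`DoubledWeilRepresentationArchHalfReal.exists_isArchHalf_real` (three-block archimedean section `archWeilHalf3D` of seat GR-2 twisted
by the character pinned by the parabolic prescription; all three archimedean place types — real with `E_v = ℂ`, real with
`E_v = ℝ × ℝ`, complex), fed with the enumeration `QuadExtRealPlacesEquiv.realPlacesEquivTypeTwo` of the real places of `E`.

* **`GRConstructionGen.exists_isArchHalf_diagonal`** — the archimedean half at the consumer's diagonal data;
* **`Prop311.prop311AsPrinted_holds : Prop311AsPrinted`**.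

Scope statement.  This closes the TRACK-2 proof-formalisation of [GR91 Prop. 3.1.1] as typed in `Prop311AsPrinted.lean` (renderings
R1–R8 of that file's module docstring: the metaplectic group is the tree's `Mp(𝕎^𝔻)ᶜᵒⁿᵗ` model, the splitting is produced by the
doubling construction of [GR91 §3.2] / [Kudla1994 §3]).  It is a statement about the Weil representation and unitary groups ONLY;
nothing in this file is a claim of the manuscripts adjudicated by the Hodge-CM cell, and HC_CM is NOT proved here.

## References
* [GelbartRogawski1991] S. Gelbart, J. Rogawski, Invent. Math. 105 (1991) 445–472, §3.1 Proposition 3.1.1 p. 455 L1–3, §3.2 p. 457.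
* [Kudla1994] S. Kudla, Israel J. Math. 87 (1994), §3 Thm. 3.1.
-/

set_option autoImplicit false

noncomputable section

open scoped Classical
open scoped Matrix
open NumberField IsDedekindDomain
open Literature.RepresentationTheory.HeisenbergGroup
open Literature.NumberTheory.Automorphic Literature.NumberTheory.Automorphic.UnitaryGroup
open Literature.NumberTheory.Weil1964
open Literature.NumberTheory.GaloisRepresentations
open Literature.RepresentationTheory.HarrisKudlaSweet1996

namespace Literature.NumberTheory.GelbartRogawski1991

namespace GRConstructionGen

open UnitaryDualPair

/-- **THE ARCHIMEDEAN HALF AT DIAGONAL DATA, EVERY QUADRATIC `E/F`**: for `c δ = -δ ≠ 0`, diagonal Gram data with non-zero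
entries and a unitary Hecke character `χ` of `E` with `χ|_{𝕀_F} = ε_{E/F}`, an archimedean half `sa` exists
(`exists_isArchHalf_real` with the enumeration `realPlacesEquivTypeTwo` of the real places of `E`).
[cite: GelbartRogawski1991, §3.1 Prop. 3.1.1 p. 455] [cite: Kudla1994, §3] -/
theorem exists_isArchHalf_diagonal (F : Type) [Field F] [NumberField F] (E : Type) [Field E] [NumberField E] [Algebra F E]
    [Algebra.IsQuadraticExtension F E] (c : E ≃ₐ[F] E) {δ : E} (hcδ : c δ = -δ) (hδ : δ ≠ 0) {d : F}
    (hd : δ * δ = algebraMap F E d) {N M n : ℕ} (e : Fin N × Fin M ≃ Fin n)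
    (dV : Fin N → F) (hV : (Matrix.diagonal dV).IsSymm) (hVd : IsUnit (Matrix.diagonal dV).det) (hdV0 : ∀ i, dV i ≠ 0)
    (dW : Fin M → F) (hW : (Matrix.diagonal dW).IsSymm) (hWd : IsUnit (Matrix.diagonal dW).det) (hdW0 : ∀ j, dW j ≠ 0)
    {χ : HeckeCharacter E} (hχu : χ.IsUnitary) (hχ : IsSplittingCharExt F E 1 χ) :
    ∃ sa : arch F E c (n + n) (hermD F E e (Matrix.diagonal dV) (Matrix.diagonal dW)) →*
        MpD F e (Matrix.diagonal dV) (Matrix.diagonal dW),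
      IsArchHalf F E c hcδ hδ hd e (Matrix.diagonal dV) hV hVd (Matrix.diagonal dW) hW hWd χ sa :=
  exists_isArchHalf_real F E c hcδ hδ hd e dV hV hVd hdV0 dW hW hWd hdW0 hχu hχ
    (realPlacesEquivTypeTwo F E c (LocalSplitting.galConj_ne_one_of_delta F E c hcδ hδ)) (fun _ => rfl) (fun _ => rfl)

end GRConstructionGen

namespace Prop311

/-- **[GelbartRogawski1991, Proposition 3.1.1] AS PRINTED HOLDS**: for every quadratic extension of number fields `E/F` and every
non-degenerate hermitian space, the metaplectic cover splits over the doubled unitary group `G(𝐀)`, continuously and compatibly with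
the rational splitting — the `def Prop311AsPrinted : Prop` of `Prop311AsPrinted.lean` is inhabited, by
`prop311AsPrinted_of_diagonalArchHalf` and `GRConstructionGen.exists_isArchHalf_diagonal`.
[cite: GelbartRogawski1991, §3.1 Proposition 3.1.1 p. 455 L1–3] [cite: Kudla1994, §3 Thm. 3.1] -/
theorem prop311AsPrinted_holds : Prop311AsPrinted := by
  refine prop311AsPrinted_of_diagonalArchHalf ?_
  intro F _ _ E _ _ _ _ c δ hcδ hδ d hd N M n e dV hdV0 dW hdW0 χ hχu hχ
  exact GRConstructionGen.exists_isArchHalf_diagonal F E c hcδ hδ hd e dV (Matrix.isSymm_diagonal dV)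
    (isUnit_det_diagonal_of_ne_zero dV hdV0) hdV0 dW (Matrix.isSymm_diagonal dW) (isUnit_det_diagonal_of_ne_zero dW hdW0)
    hdW0 hχu hχ

end Prop311

end Literature.NumberTheory.GelbartRogawski1991

end
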